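import Literature.NumberTheory.Automorphic.UnitaryLatticeTreeEulerRelation   -- ★ root star = `K₀·N₁`, `N_x` membership (`exists_mem_neighborSet_root_forall_mem_iff`, `eq_of_forall_mem_iff`)
import Literature.NumberTheory.Automorphic.UnitaryLatticeTreeFixedStar       -- ★ fixed-star test `latticeGraphIso_N₁_eq_iff`, ★ `firstColumn_props`, ★ `mem_mapGL_N₁_iff` (via T1d-C1)
import HarnessLib

/-!
# R90 · S6 «Ch. 14.1–14.5 stable trace formula» — card W8-i″, FILE 3d (RESIDUAL VALUE «TRANSVECTION»): a `k ∈ K₀` that is residually a scalar plus the CORNER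
# `E₂₀` fixes EXACTLY ONE special neighbour of the hyperspecial root — `#{w ∈ star(L₀) | k·w = w} = 1` (`Theorems/R90S6ResidualStarFixedTransvection.lean`)

Cell `hodgecm-mathlib`, crux H413 (`stmt-HodgeConjecture-24833`), route of record `HCCMUnconditional`; programme R90-TF, section S6 (base `R90-C14`), seat R90-C14-p05 (g0);
S6 dealer R90-C14-plan (g2) 00:08:43Z «3d (residually unipotent ↦ 1) «=» START» (DAG r5 row E1.3.5.2.4).  Helper lane `--supports stmt-HodgeConjecture-24833 --as helper`;
ONE theorem (no definition, no instance, no notation, no named fact, no `sorry`); imports = ★ `UnitaryLatticeTreeEulerRelation` + ★ `UnitaryLatticeTreeFixedStar` + HarnessLib.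

THE MATHEMATICS [Wilson2009, §3.6.1; BruhatTits1972, §10; Tits1979, §3.5].  `K` a valued field with an unramified datum `hd : UnramifiedLocalConjDatum σ ϖ`, `U = U(σ, J₀)(K)`,
`B₀ x y = σx₀y₂ + σx₁y₁ + σx₂y₀`, `K₀ = U ∩ GL₃(𝒪)`, `L₀ = 𝒪³`, star `= {κ·N₁ | κ ∈ K₀}` = `{N_x | x primitive isotropic}`, `N_x = {y ∈ 𝒪³ | B₀ x y ∈ 𝔪}`.  Let
`k ∈ K₀` be residually `c·(1 + t E₂₀)` with `|c| = |t| = 1`: `|k_{ij} − c δ_{ij}| < 1` for `(i,j) ≠ (2,0)` and `|k₂₀| = 1` — a residual TRANSVECTION with the isotropic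
centre `e₂` (this is EXACTLY the shape of the local monodromy `k_x = t_j⁻¹ κ⁻¹ γ κ t_j` of a deep elliptic `γ = ζ(1 + ϖ^{2j} Y)` at a hyperspecial vertex `x = κ t_j·x₀` at
distance `2j`, whenever `(κ⁻¹Yκ)₂₀ = B₀(κe₀, Yκe₀)` is a unit).  Then `k` fixes EXACTLY ONE vertex of the star, namely `N_{e₂} = {y ∈ 𝒪³ | y₀ ∈ 𝔪}` (= `latt diag(ϖ,1,1)`,
the neighbour «towards `x₀`» in the application): (i) `N_{e₂}` is fixed — `(k z)₀ ≡ c z₀ (mod 𝔪)` for integral `z`; (ii) if `κ·N₁ = N_x` is fixed, `x = κe₀` (integral,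
primitive, `B₀(x,x) = 0`, ★ `firstColumn_props`) satisfies `k x ≡ c′x` (★ `latticeGraphIso_N₁_eq_iff`); `|x₀| = 1` would give `c′ ≡ c` from row `0` and then `|k₂₀x₀| < 1`
from row `2` — impossible; so `x₀ ∈ 𝔪`, isotropy `σx₁x₁ = −(σx₀x₂ + σx₂x₀) ∈ 𝔪` gives `x₁ ∈ 𝔪`, primitivity `|x₂| = 1`, whence `N_x = N_{e₂}` (`B₀ x y ≡ σx₂·y₀`).  So
**`{w ∈ star(L₀) | k·w = w} = {N_{e₂}}`**, `ncard = 1` — the value «transvection ↦ 1» of the residual census `s(x)` of ★ FILE 1 ∘ ★ FILE 2 ([Wilson2009] §3.6.1: a unitary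
transvection fixes exactly the isotropic points orthogonal to its centre, and in a non-degenerate hermitian 3-space the only isotropic point orthogonal to an isotropic `v` is
`[v]`).  Pure valuation algebra: no residue field, no finiteness.  CAUTION recorded for the census (this seat, 00:1xZ): at the boundary vertices where `B₀(κe₀, Yκe₀) ∈ 𝔪` the
monodromy is residually SCALAR instead (★ FILE 3a: all `q³+1` neighbours fixed) — the fixed set of an equidistant type-(1) element of depth `ρ ≥ 2` is therefore NOT the ball
`B(x₀, ρ)` (Flicker's second exponent `N₊` records exactly this).
HONEST LABEL: lattice ∕ valuation bookkeeping over ★ organs; count-neutral until the per-literal censuses + W8-f consume it; proves no printed statement.  HC_CM is proved only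
modulo the 7 printed citations (2 remaining named inputs: hLiu418 = stmt-HodgeConjecture-24832, h413 = stmt-HodgeConjecture-24833) until rung 0 closes.
-/

set_option autoImplicit false
-- the mandated namespace repeats the single-problem summit's segment (`HodgeConjecture.HodgeConjecture`)
set_option linter.dupNamespace false

noncomputable section

open Literature.NumberTheory.Automorphic Literature.NumberTheory.Automorphic.HermitianLattice Literature.NumberTheory.Automorphic.UnitaryGroup
open Literature.NumberTheory.Automorphic.UnitaryLatticeTree Literature.NumberTheory.Automorphic.CartanUnique
open scoped Matrix MatrixGroups WithZero Valued

namespace Summit.HodgeConjecture.HodgeConjecture.R90.S6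

/-- **W8-i″ FILE 3d — A RESIDUAL TRANSVECTION `k ≡ c(1 + tE₂₀)` (`|c| = |t| = 1`) IN `K₀` FIXES EXACTLY ONE VERTEX OF THE STAR OF THE ROOT: `#{w ∈ star(L₀) | k·w = w} = 1`.**
For an unramified datum `hd` and `k ∈ K₀ = U(σ,J₀) ∩ GL₃(𝒪)` with `|k_{ij} − cδ_{ij}| < 1` for all `(i,j) ≠ (2,0)` and `|k₂₀| = 1`: the `k`-fixed vertices of the star of
`L₀ = 𝒪³` in ★ `latticeGraph σ ϖ J₀` form the singleton `{N_{e₂}}`, `N_{e₂} = {y ∈ 𝒪³ | y₀ ∈ 𝔪}`, so the count of ★ FILE 2 is `1`.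
[cite: Wilson2009, §3.6.1] [cite: BruhatTits1972, §10] [cite: Tits1979, §3.5] -/
theorem ncard_fixed_neighborSet_root_eq_one_of_residually_transvection {K : Type*} [Field K] [Valued K ℤᵐ⁰]
    {σ : K →+* K} {ϖ : K} (hd : UnramifiedLocalConjDatum σ ϖ)
    (k : ↥(unitaryGroupOfForm σ ((StdForm.antidiagonal 3).over K))) (hk : k ∈ unitaryInt σ ((StdForm.antidiagonal 3).over K))
    {c : K} (hc : Valued.v c = 1)
    (hkc : ∀ i j : Fin 3, (i, j) ≠ ((2 : Fin 3), (0 : Fin 3)) →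
      Valued.v (((k : GL (Fin 3) K) : Matrix (Fin 3) (Fin 3) K) i j - c * (1 : Matrix (Fin 3) (Fin 3) K) i j) < 1)
    (h20 : Valued.v (((k : GL (Fin 3) K) : Matrix (Fin 3) (Fin 3) K) 2 0) = 1) :
    {w : {M : Submodule 𝒪[K] (Fin 3 → K) // IsVertex σ ϖ ((StdForm.antidiagonal 3).over K) M} |
        w ∈ (latticeGraph σ ϖ ((StdForm.antidiagonal 3).over K)).neighborSet ⟨stdLattice K 3, 0, isSelfDualLattice_stdLattice_three hd⟩ ∧
          latticeGraphIso σ ϖ ((StdForm.antidiagonal 3).over K) k w = w}.ncard = 1 := by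
  classical
  have hϖ0 : ϖ ≠ 0 := uniformizer_ne_zero hd.vϖ
  have hϖ1 : Valued.v ϖ ≤ 1 := uniformizer_mem_integer hd.vϖ
  have hlt1 : ∀ z : K, Valued.v z < 1 ↔ Valued.v z ≤ Valued.v ϖ := fun z => by rw [hd.vϖ]; exact v_lt_one_iff z
  set kM : Matrix (Fin 3) (Fin 3) K := ((k : GL (Fin 3) K) : Matrix (Fin 3) (Fin 3) K) with hkM
  have hkint : ∀ i j, Valued.v (kM i j) ≤ 1 := (mem_unitaryInt_iff.1 hk).1
  -- the diagonal entries are units congruent to `c`, the off-corner off-diagonal entries are in `𝔪`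
  have hdiag : ∀ i, Valued.v (kM i i - c) < 1 := fun i => by
    have h := hkc i i (by intro h; fin_cases i <;> simp_all)
    rwa [Matrix.one_apply_eq, mul_one] at h
  have hoff : ∀ i j : Fin 3, i ≠ j → (i, j) ≠ ((2 : Fin 3), (0 : Fin 3)) → Valued.v (kM i j) < 1 := fun i j hij hne => by
    have h := hkc i j hne
    rwa [Matrix.one_apply_ne hij, mul_zero, sub_zero] at h
  -- ROW 0 of `k z`: `(k z)₀ ≡ c z₀ (mod 𝔪)` for integral `z`
  have hrow0 : ∀ z : Fin 3 → K, z ∈ stdLattice K 3 → Valued.v ((kM.mulVec z) 0 - c * z 0) < 1 := by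
    intro z hz
    have e : (kM.mulVec z) 0 - c * z 0 = (kM 0 0 - c) * z 0 + (kM 0 1 * z 1 + kM 0 2 * z 2) := by
      simp only [Matrix.mulVec, dotProduct, Fin.sum_univ_three]; ring
    rw [e]
    refine Valuation.map_add_lt _ ?_ (Valuation.map_add_lt _ ?_ ?_)
    · rw [map_mul]
      calc Valued.v (kM 0 0 - c) * Valued.v (z 0) ≤ Valued.v (kM 0 0 - c) * 1 := mul_le_mul' le_rfl (hz 0)
        _ < 1 := by rw [mul_one]; exact hdiag 0
    · rw [map_mul]
      calc Valued.v (kM 0 1) * Valued.v (z 1) ≤ Valued.v (kM 0 1) * 1 := mul_le_mul' le_rfl (hz 1)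
        _ < 1 := by rw [mul_one]; exact hoff 0 1 (by decide) (by decide)
    · rw [map_mul]
      calc Valued.v (kM 0 2) * Valued.v (z 2) ≤ Valued.v (kM 0 2) * 1 := mul_le_mul' le_rfl (hz 2)
        _ < 1 := by rw [mul_one]; exact hoff 0 2 (by decide) (by decide)
  -- the candidate fixed vertex `W₂ = N_{e₂} = {y ∈ 𝒪³ | y₀ ∈ 𝔪}`
  have he2int : (Pi.single 2 1 : Fin 3 → K) ∈ stdLattice K 3 := single_mem_stdLattice 2
  have he2unit : ∃ j, Valued.v ((Pi.single 2 1 : Fin 3 → K) j) = 1 := ⟨2, by rw [Pi.single_eq_same, map_one]⟩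
  have he2iso : Valued.v (B₀ σ 3 (Pi.single 2 1 : Fin 3 → K) (Pi.single 2 1)) < 1 := by
    rw [B₀_single_left, show Fin.rev (2 : Fin 3) = 0 from rfl, Pi.single_eq_of_ne (by decide), map_zero]; exact zero_lt_one
  obtain ⟨W₂, hW₂, hW₂mem⟩ := exists_mem_neighborSet_root_forall_mem_iff hd he2int he2unit he2iso
  have hW₂mem' : ∀ y, y ∈ W₂.1 ↔ y ∈ stdLattice K 3 ∧ Valued.v (y 0) < 1 := fun y => by
    rw [hW₂mem y, B₀_single_left, show Fin.rev (2 : Fin 3) = 0 from rfl]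
  -- (i) `W₂` is fixed by `k`
  have hW₂fix : latticeGraphIso σ ϖ ((StdForm.antidiagonal 3).over K) k W₂ = W₂ := by
    rw [latticeGraphIso_apply_eq_self_iff]
    apply SetLike.ext
    intro y
    rw [mem_mapGL_iff, hW₂mem', hW₂mem']
    -- `z := k⁻¹ y`, `y = k z`
    have hkz : kM.mulVec ((((k⁻¹ : ↥(unitaryGroupOfForm σ ((StdForm.antidiagonal 3).over K))) : GL (Fin 3) K) : Matrix (Fin 3) (Fin 3) K).mulVec y) = y := by
      rw [Matrix.mulVec_mulVec, hkM, Subgroup.coe_inv, ← Units.val_mul, mul_inv_cancel, Units.val_one, Matrix.one_mulVec]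
    rw [← Subgroup.coe_inv]
    constructor
    · rintro ⟨hz, hz0⟩
      have hy : y ∈ stdLattice K 3 := by rw [← hkz]; exact mulVec_mem_stdLattice_of_mem_unitaryInt hk hz
      refine ⟨hy, ?_⟩
      have h := hrow0 _ hz
      rw [hkz] at h
      -- `|y₀ − c z₀| < 1` and `|c z₀| < 1`
      have hcz : Valued.v (c * (((((k⁻¹ : ↥(unitaryGroupOfForm σ ((StdForm.antidiagonal 3).over K))) : GL (Fin 3) K) : Matrix (Fin 3) (Fin 3) K).mulVec y) 0)) < 1 := by
        rw [map_mul, hc, one_mul]; exact hz0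
      have e : y 0 = (y 0 - c * (((((k⁻¹ : ↥(unitaryGroupOfForm σ ((StdForm.antidiagonal 3).over K))) : GL (Fin 3) K) : Matrix (Fin 3) (Fin 3) K).mulVec y) 0)) +
          c * (((((k⁻¹ : ↥(unitaryGroupOfForm σ ((StdForm.antidiagonal 3).over K))) : GL (Fin 3) K) : Matrix (Fin 3) (Fin 3) K).mulVec y) 0) := by ring
      rw [e]
      exact Valuation.map_add_lt _ h hcz
    · rintro ⟨hy, hy0⟩
      have hz : ((((k⁻¹ : ↥(unitaryGroupOfForm σ ((StdForm.antidiagonal 3).over K))) : GL (Fin 3) K) : Matrix (Fin 3) (Fin 3) K).mulVec y) ∈ stdLattice K 3 :=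
        mulVec_mem_stdLattice_of_mem_unitaryInt_inv hk hy
      refine ⟨hz, ?_⟩
      have h := hrow0 _ hz
      rw [hkz] at h
      -- `|c z₀| ≤ max(|y₀|, |y₀ − c z₀|) < 1`
      have e : c * (((((k⁻¹ : ↥(unitaryGroupOfForm σ ((StdForm.antidiagonal 3).over K))) : GL (Fin 3) K) : Matrix (Fin 3) (Fin 3) K).mulVec y) 0) =
          y 0 - (y 0 - c * (((((k⁻¹ : ↥(unitaryGroupOfForm σ ((StdForm.antidiagonal 3).over K))) : GL (Fin 3) K) : Matrix (Fin 3) (Fin 3) K).mulVec y) 0)) := by ring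
      have hcz : Valued.v (c * (((((k⁻¹ : ↥(unitaryGroupOfForm σ ((StdForm.antidiagonal 3).over K))) : GL (Fin 3) K) : Matrix (Fin 3) (Fin 3) K).mulVec y) 0)) < 1 := by
        rw [e]; exact Valuation.map_sub_lt _ hy0 h
      rwa [map_mul, hc, one_mul] at hcz
  -- (ii) every fixed vertex of the star is `W₂`
  have huniq : ∀ w : {M : Submodule 𝒪[K] (Fin 3 → K) // IsVertex σ ϖ ((StdForm.antidiagonal 3).over K) M},
      w ∈ (latticeGraph σ ϖ ((StdForm.antidiagonal 3).over K)).neighborSet ⟨stdLattice K 3, 0, isSelfDualLattice_stdLattice_three hd⟩ →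
      latticeGraphIso σ ϖ ((StdForm.antidiagonal 3).over K) k w = w → w = W₂ := by
    intro w hw hfix
    obtain ⟨κ, hκ, hw1⟩ := (mem_neighborSet_root_iff_exists_mem_unitaryInt hd w).1 hw
    obtain ⟨c', hc', hcol⟩ := (latticeGraphIso_N₁_eq_iff hd.vσ hd.vϖ hk hκ w hw1).1 hfix
    set κM : Matrix (Fin 3) (Fin 3) K := ((κ : GL (Fin 3) K) : Matrix (Fin 3) (Fin 3) K) with hκM
    obtain ⟨x, hx⟩ : ∃ x : Fin 3 → K, x = κM.mulVec (Pi.single 0 1) := ⟨_, rfl⟩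
    obtain ⟨hxint, hxiso, i₀, hxi₀⟩ := firstColumn_props hκ
    rw [← hκM, ← hx] at hxint hxiso hxi₀
    have hxcol : ∀ i, x i = κM i 0 := fun i => by rw [hx, Matrix.mulVec_single_one]; rfl
    -- `(k x)_i ≡ c′ x_i`
    have hcol' : ∀ i, Valued.v ((kM.mulVec x) i - c' * x i) < 1 := by
      intro i
      have e : (kM.mulVec x) i - c' * x i = (kM * κM) i 0 - c' * κM i 0 := by
        rw [hxcol, Matrix.mul_apply]
        simp only [Matrix.mulVec, dotProduct, hxcol]
      rw [e]
      exact hcol i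
    -- expansions of rows 0 and 2 of `k x`
    have hr0 : (kM.mulVec x) 0 - c' * x 0 = (c - c') * x 0 + ((kM 0 0 - c) * x 0 + (kM 0 1 * x 1 + kM 0 2 * x 2)) := by
      simp only [Matrix.mulVec, dotProduct, Fin.sum_univ_three]; ring
    have hr2 : (kM.mulVec x) 2 - c' * x 2 = kM 2 0 * x 0 + ((c - c') * x 2 + ((kM 2 2 - c) * x 2 + kM 2 1 * x 1)) := by
      simp only [Matrix.mulVec, dotProduct, Fin.sum_univ_three]; ring
    have hsmall0 : Valued.v ((kM 0 0 - c) * x 0 + (kM 0 1 * x 1 + kM 0 2 * x 2)) < 1 := by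
      refine Valuation.map_add_lt _ ?_ (Valuation.map_add_lt _ ?_ ?_)
      · rw [map_mul]
        calc Valued.v (kM 0 0 - c) * Valued.v (x 0) ≤ Valued.v (kM 0 0 - c) * 1 := mul_le_mul' le_rfl (hxint 0)
          _ < 1 := by rw [mul_one]; exact hdiag 0
      · rw [map_mul]
        calc Valued.v (kM 0 1) * Valued.v (x 1) ≤ Valued.v (kM 0 1) * 1 := mul_le_mul' le_rfl (hxint 1)
          _ < 1 := by rw [mul_one]; exact hoff 0 1 (by decide) (by decide)
      · rw [map_mul]
        calc Valued.v (kM 0 2) * Valued.v (x 2) ≤ Valued.v (kM 0 2) * 1 := mul_le_mul' le_rfl (hxint 2)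
          _ < 1 := by rw [mul_one]; exact hoff 0 2 (by decide) (by decide)
    -- `x₀ ∈ 𝔪`
    have hx0 : Valued.v (x 0) < 1 := by
      by_contra hge
      have hx0' : Valued.v (x 0) = 1 := le_antisymm (hxint 0) (not_lt.1 hge)
      -- row 0: `|c − c′| < 1`
      have hcc : Valued.v (c - c') < 1 := by
        have h := hcol' 0
        rw [hr0] at h
        have e : (c - c') * x 0 = ((c - c') * x 0 + ((kM 0 0 - c) * x 0 + (kM 0 1 * x 1 + kM 0 2 * x 2))) -
            ((kM 0 0 - c) * x 0 + (kM 0 1 * x 1 + kM 0 2 * x 2)) := by ring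
        have h' : Valued.v ((c - c') * x 0) < 1 := by rw [e]; exact Valuation.map_sub_lt _ h hsmall0
        rwa [map_mul, hx0', mul_one] at h'
      -- row 2: `|k₂₀ x₀| < 1`, contradiction
      have hsmall2 : Valued.v ((c - c') * x 2 + ((kM 2 2 - c) * x 2 + kM 2 1 * x 1)) < 1 := by
        refine Valuation.map_add_lt _ ?_ (Valuation.map_add_lt _ ?_ ?_)
        · rw [map_mul]
          calc Valued.v (c - c') * Valued.v (x 2) ≤ Valued.v (c - c') * 1 := mul_le_mul' le_rfl (hxint 2)
            _ < 1 := by rw [mul_one]; exact hcc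
        · rw [map_mul]
          calc Valued.v (kM 2 2 - c) * Valued.v (x 2) ≤ Valued.v (kM 2 2 - c) * 1 := mul_le_mul' le_rfl (hxint 2)
            _ < 1 := by rw [mul_one]; exact hdiag 2
        · rw [map_mul]
          calc Valued.v (kM 2 1) * Valued.v (x 1) ≤ Valued.v (kM 2 1) * 1 := mul_le_mul' le_rfl (hxint 1)
            _ < 1 := by rw [mul_one]; exact hoff 2 1 (by decide) (by decide)
      have h := hcol' 2
      rw [hr2] at h
      have e : kM 2 0 * x 0 = (kM 2 0 * x 0 + ((c - c') * x 2 + ((kM 2 2 - c) * x 2 + kM 2 1 * x 1))) -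
          ((c - c') * x 2 + ((kM 2 2 - c) * x 2 + kM 2 1 * x 1)) := by ring
      have h' : Valued.v (kM 2 0 * x 0) < 1 := by rw [e]; exact Valuation.map_sub_lt _ h hsmall2
      rw [map_mul, h20, hx0', mul_one] at h'
      exact lt_irrefl _ h'
    -- `x₁ ∈ 𝔪` by isotropy `σx₀x₂ + σx₁x₁ + σx₂x₀ = 0`
    have hx1 : Valued.v (x 1) < 1 := by
      have hB : σ (x 0) * x 2 + (σ (x 1) * x 1 + σ (x 2) * x 0) = 0 := by
        rw [B₀_apply, Fin.sum_univ_three] at hxiso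
        simpa [show Fin.rev (0 : Fin 3) = 2 from rfl, show Fin.rev (1 : Fin 3) = 1 from rfl, show Fin.rev (2 : Fin 3) = 0 from rfl, add_assoc] using hxiso
      have e : σ (x 1) * x 1 = -(σ (x 0) * x 2 + σ (x 2) * x 0) := by linear_combination hB
      have hsq : Valued.v (σ (x 1) * x 1) < 1 := by
        rw [e, Valuation.map_neg]
        refine Valuation.map_add_lt _ ?_ ?_
        · rw [map_mul, hd.vσ]
          calc Valued.v (x 0) * Valued.v (x 2) ≤ Valued.v (x 0) * 1 := mul_le_mul' le_rfl (hxint 2)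
            _ < 1 := by rw [mul_one]; exact hx0
        · rw [map_mul, hd.vσ]
          calc Valued.v (x 2) * Valued.v (x 0) ≤ 1 * Valued.v (x 0) := mul_le_mul' (hxint 2) le_rfl
            _ < 1 := by rw [one_mul]; exact hx0
      by_contra hge
      have hx1' : Valued.v (x 1) = 1 := le_antisymm (hxint 1) (not_lt.1 hge)
      rw [map_mul, hd.vσ, hx1', mul_one] at hsq
      exact lt_irrefl _ hsq
    -- `|x₂| = 1` by primitivity
    have hx2 : Valued.v (x 2) = 1 := by
      fin_cases i₀
      · exact absurd hxi₀ hx0.ne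
      · exact absurd hxi₀ hx1.ne
      · exact hxi₀
    -- hence `N_x = N_{e₂}`: membership through `B₀ x y ≡ σx₂ · y₀`
    apply eq_of_forall_mem_iff
    intro y
    rw [hW₂mem' y, hw1]
    constructor
    · intro hy
      have hyL : y ∈ stdLattice K 3 := (mapGL_N₁_le hκ hϖ1 hϖ0).2 hy
      have hB : Valued.v (B₀ σ 3 x y) < 1 := by rw [hx] at *; exact (hlt1 _).2 ((mem_mapGL_N₁_iff hκ hϖ0 hyL).1 hy)
      refine ⟨hyL, ?_⟩
      -- `σx₂ y₀ = B₀ x y − (σx₀ y₂ + σx₁ y₁)`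
      have e : σ (x 2) * y 0 = B₀ σ 3 x y - (σ (x 0) * y 2 + σ (x 1) * y 1) := by
        rw [B₀_apply, Fin.sum_univ_three, show Fin.rev (0 : Fin 3) = 2 from rfl, show Fin.rev (1 : Fin 3) = 1 from rfl,
          show Fin.rev (2 : Fin 3) = 0 from rfl]
        ring
      have hsm : Valued.v (σ (x 0) * y 2 + σ (x 1) * y 1) < 1 := by
        refine Valuation.map_add_lt _ ?_ ?_
        · rw [map_mul, hd.vσ]
          calc Valued.v (x 0) * Valued.v (y 2) ≤ Valued.v (x 0) * 1 := mul_le_mul' le_rfl (hyL 2)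
            _ < 1 := by rw [mul_one]; exact hx0
        · rw [map_mul, hd.vσ]
          calc Valued.v (x 1) * Valued.v (y 1) ≤ Valued.v (x 1) * 1 := mul_le_mul' le_rfl (hyL 1)
            _ < 1 := by rw [mul_one]; exact hx1
      have h : Valued.v (σ (x 2) * y 0) < 1 := by rw [e]; exact Valuation.map_sub_lt _ hB hsm
      rwa [map_mul, hd.vσ, hx2, one_mul] at h
    · rintro ⟨hyL, hy0⟩
      rw [hx] at hx0 hx1 hx2
      refine (mem_mapGL_N₁_iff hκ hϖ0 hyL).2 ((hlt1 _).1 ?_)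
      rw [B₀_apply, Fin.sum_univ_three, show Fin.rev (0 : Fin 3) = 2 from rfl, show Fin.rev (1 : Fin 3) = 1 from rfl,
        show Fin.rev (2 : Fin 3) = 0 from rfl]
      refine Valuation.map_add_lt _ (Valuation.map_add_lt _ ?_ ?_) ?_
      · rw [map_mul, hd.vσ]
        calc Valued.v (κM.mulVec (Pi.single 0 1) 0) * Valued.v (y 2) ≤ Valued.v (κM.mulVec (Pi.single 0 1) 0) * 1 := mul_le_mul' le_rfl (hyL 2)
          _ < 1 := by rw [mul_one]; exact hx0
      · rw [map_mul, hd.vσ]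
        calc Valued.v (κM.mulVec (Pi.single 0 1) 1) * Valued.v (y 1) ≤ Valued.v (κM.mulVec (Pi.single 0 1) 1) * 1 := mul_le_mul' le_rfl (hyL 1)
          _ < 1 := by rw [mul_one]; exact hx1
      · rw [map_mul, hd.vσ, hx2, one_mul]; exact hy0
  -- the fixed set is the singleton `{W₂}`
  have hS : {w : {M : Submodule 𝒪[K] (Fin 3 → K) // IsVertex σ ϖ ((StdForm.antidiagonal 3).over K) M} |
      w ∈ (latticeGraph σ ϖ ((StdForm.antidiagonal 3).over K)).neighborSet ⟨stdLattice K 3, 0, isSelfDualLattice_stdLattice_three hd⟩ ∧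
        latticeGraphIso σ ϖ ((StdForm.antidiagonal 3).over K) k w = w} = {W₂} := by
    ext w
    simp only [Set.mem_setOf_eq, Set.mem_singleton_iff]
    exact ⟨fun h => huniq w h.1 h.2, fun h => by subst h; exact ⟨hW₂, hW₂fix⟩⟩
  rw [hS, Set.ncard_singleton]

end Summit.HodgeConjecture.HodgeConjecture.R90.S6

end
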